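import Literature.AnabelianGeometry.SemiGraphs.Coverticial
import Literature.AnabelianGeometry.SemiGraphs.FiniteEtaleCoveringGlobalDef

/-!
# Finite étale coverings of semi-graphs of anabelioids: the GLOBAL clause `B(𝒢′) = B(𝒢)_{/A}` — STATEMENTS

Mochizuki, *Semi-graphs of anabelioids*, Publ. RIMS **42** (2006) 221–322, §2, Definition 2.2 (i)
and the paragraph before it, author's manuscript p. 23 [cite: MochizukiSemiAnbd2006, Def. 2.2(i) p.23]:
"if `B′ → B(𝒢)` is a finite étale covering [with `B′` connected], then `B′` itself arises
naturally as the `B(−)` of some semi-graph of anabelioids `𝒢′` equipped with a morphism `𝒢′ → 𝒢`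
… `B′ = B(𝒢)_{G′}`".

abc-iut cell, DISCHARGE-L3 TREE-HEALTH RQ11 / RULING ζ2 (L3-lead 2026-08-25T21:56:58Z; finder
abc-iut-L6-d4, witness `HOME/staging/L6/L6-d4/audit/A-L6d4-G30-F1.md`, an `S₃/A₃` double loop):
abc-iut-L3-t1's `Hom.IsFiniteEtaleCoveringOf φ A` (`Coverticial.lean`, Def. 2.2 (i)) types print's
LOCAL description of the covering `𝒢′ → 𝒢` attached to `A = G′` (vertices/edges = connected
components of the `S_v`, `T_e`; constituents = the component anabelioids) and does NOT pin the
gluing of `𝒢′`, hence does not imply the GLOBAL clause "`B(𝒢′)` is `B(𝒢)_{/A}` via `φ^*`" — which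
the decomposition-group statements (D1)–(D3), (D6), (D7) of `FiniteEtaleCoveringDictionary.lean`
need.  This additive statements file (Coverticial untouched) names:

* (v3, rulings κ2/π2: the definition formerly here, `Hom.IsBObjCoveringOf` — the global clause
  `φ^* ≅ (A × −) ⋙ α` for an equivalence `α : B(𝒢)_{/A} ⥲ B(𝒢′)` — now lives, body verbatim, as
  `Hom.IsGlobalCoveringOf` in the Coverticial-independent `FiniteEtaleCoveringGlobalDef.lean`, next to
  abc-iut-L4-t17's `Hom.IsBranchAligned`; the old name is DELETED here, all users having migrated);
* `exists_finiteEtaleCovering_global` — the existence fact of p. 23 with the global clause (two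
  clauses); the plain `exists_finiteEtaleCovering` of `Coverticial.lean` is the local clause only, and
  the four-clause fact of record is `exists_finiteEtaleCoveringGlobal` (dictionary v3).

G1 (junk/vacuity): for `A` terminal, `Over A ≌ B(𝒢)` and `Over.star A ≅` that equivalence, so the
identity covering satisfies `IsGlobalCoveringOf` — consistent; L6-d4's witness shows the local
predicate can hold while the global clause fails, so the new hypothesis is not redundant.  No
`_holds` here (discharger of G25⁺: abc-iut-L3-t5, ruling ζ2 (c)).  Nothing here takes a side on
[IUTchIII] Cor. 3.12; typed ≠ discharged.
-/

namespace Literature.AnabelianGeometry.SemiGraphs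

open CategoryTheory CategoryTheory.Limits

universe v₁ u₁ u

namespace SemiGraphOfAnabelioids

variable {𝒢 𝒢' : SemiGraphOfAnabelioids.{v₁, u₁, u}}

/-- NAMED FACT (G25⁺), [SemiAnbd] p. 23: for a connected semi-graph of anabelioids `𝒢` with a vertex
and every object `A` of `B(𝒢)`, there is a semi-graph of anabelioids `𝒢′` with a morphism
`φ : 𝒢′ → 𝒢` which is the finite étale covering attached to `A` BOTH locally (t1's
`IsFiniteEtaleCoveringOf`, Def. 2.2 (i)) AND globally (`IsGlobalCoveringOf`: `B(𝒢′) ≃ B(𝒢)_{/A}` via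
`φ^*`; v3: retyped over the name of record, ruling π2).  The local clause alone is
`exists_finiteEtaleCovering` (`Coverticial.lean`); by abc-iut-L6-d4's witness (RQ11) it does not
imply the global clause.  The FOUR-clause fact of record (adding branch and vertex alignment,
rulings μ2/ρ2) is `exists_finiteEtaleCoveringGlobal` (`FiniteEtaleCoveringDictionary.lean`), which
implies this one. [cite: MochizukiSemiAnbd2006, Def. 2.2(i) p.23] -/
def exists_finiteEtaleCovering_global : Prop :=
  ∀ (𝒢 : SemiGraphOfAnabelioids.{v₁, u₁, u}), 𝒢.IsConnected → Nonempty 𝒢.graph.Vertex →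
    ∀ A : 𝒢.BObj, ∃ (𝒢' : SemiGraphOfAnabelioids.{v₁, u₁, u}) (φ : Hom 𝒢' 𝒢),
      φ.IsFiniteEtaleCoveringOf A ∧ φ.IsGlobalCoveringOf A

end SemiGraphOfAnabelioids

end Literature.AnabelianGeometry.SemiGraphs
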